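import Summits.CriticalPhenomena.PercolationContinuityZ3.Theorems.PercNearOneGluingNoHeavyLowerTailAntitheticTopEar
import Summits.CriticalPhenomena.PercolationContinuityZ3.Theorems.PercNearOneGluingNoHeavyLowerTailAntitheticFreezeBoxes
import HarnessLib

/-!
# `NoHeavyLowerTail` (stmt-CriticalPhenomena-4575) — antithetic cluster pairs: **TOP_shift IS STABLE UNDER ADDING A COMMON NEIGHBOUR OF
# THE SOURCE AND THE TARGET**, and cylinder ∩ `{L ∩ Y = ∅}` sums are nonnegative on every graph (prim-hp-2 gen 69, HOME/MEMO-gen69.md §1(f))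

Support file (`--supports stmt-CriticalPhenomena-4575`, hull-port prover `prim-hp-2`, gen 69).  No definitions, no named facts, no sorries;
standard axioms.  Notation of …AntitheticTopEar (`X T = openCluster (T ∩ E) s`, `Y T = openCluster (Tᶜ ∩ E) s`; TOP_shift(K; P) = the
shifted sum on `{P ∈ X ∖ Y}` is ≥ 0).

* `TopCommon.cylinder_notY_sum_nonneg` — for EVERY edge set `E`, pair set `A` and vertex set `L`, and all super-odd twisted-monotone
  `K₁, K₂`: `0 ≤ Σ_{T ⊇ A, L ∩ Y T = ∅} K₁(X T, Y T)·K₂(X T, Y T)`.  (The cylinder `{T ⊇ A}` is ONE red-dominated box — its antipode off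
  `A` only removes blue pairs — so `Box.freeze_boxes_sum_nonneg` applies; `L = ∅` is …NestedTop's cylinder lemma in `K`-form.)
* `TopCommon.fubini_branch_nonneg` — the block-Fubini step used three times below and twice in …AntitheticTopEar, isolated: if `g ≥ 0` in
  sum, `g` ignores the pairs of `A`, and `h` equals `g` on `{T ∩ A = A₀}` and vanishes elsewhere, then `Σ h ≥ 0`.
* **`TopCommon.top_shift_insert_common`** — `K ∌ Q'`, `s, P, Q'` distinct: TOP_shift(K; P) ⇒ TOP_shift(K + sQ' + Q'P; P).  Branches on
  the colours of `sQ', Q'P`: both red — `P ∈ X` is automatic and the branch is the cylinder `{sQ', Q'P red} ∩ {P ∉ Y}` (first lemma);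
  red/blue — `X_E = X_K ∪ Q'`, `Y_E = Y_K`, the TOP sum of `K` for `F⁺(· ∪ Q'), G⁺(· ∪ Q')`; blue/red — `X_E = X_K ∪ Q'`, `Y_E = Y_K ∪ Q'` on
  the event, the TOP sum of `K` with BOTH sides shifted by `Q'`; blue/blue — `P ∈ Y`, empty.  So the structural and certified TOP classes
  (nested / neighbours of `s` / cones at `P` / `K_{3,3}`, octahedron, …) are closed under adding common neighbours of `s` and `P` (length-2
  ears between `s` and `P`), and with `TopVertex.vertex_sum_nonneg_of_top` / THEOREM T-EAR each such graph satisfies the |R| = 1 vertex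
  antithetic inequality at `P` / feeds a chorded-ear Δ2 family.
[cite: VandenbergHaggstromKahn2005, §1 p. 6 ("Harris' inequality"), §1 p. 3 (open cluster `C_s`)]
-/

noncomputable section

namespace Summit.CriticalPhenomena.PercolationContinuityZ3.Theorems

open Literature.Probability.Percolation
open scoped Classical

namespace Antithetic

namespace TopCommon

variable {V : Type*} [Fintype V]

/-- **Cylinder ∩ `{L ∩ Y = ∅}` sums are nonnegative on every graph** (super-odd twisted-monotone `K`-form): the cylinder `{T ⊇ A}` is a
red-dominated box. [this work] -/
theorem cylinder_notY_sum_nonneg (E : Set (Sym2 V)) (s : V) (A : Set (Sym2 V)) (L : Set V) {K₁ K₂ : Set V → Set V → ℝ}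
    (hK₁ : ∀ ⦃P P' Q Q' : Set V⦄, P ⊆ P' → Q' ⊆ Q → K₁ P Q ≤ K₁ P' Q') (hso₁ : ∀ P Q, 0 ≤ K₁ P Q + K₁ Q P)
    (hK₂ : ∀ ⦃P P' Q Q' : Set V⦄, P ⊆ P' → Q' ⊆ Q → K₂ P Q ≤ K₂ P' Q') (hso₂ : ∀ P Q, 0 ≤ K₂ P Q + K₂ Q P) :
    0 ≤ ∑ T ∈ Finset.univ.filter (fun T : Set (Sym2 V) => A ⊆ T ∧ ∀ Q ∈ L, Q ∉ openCluster (Tᶜ ∩ E) s),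
      K₁ (openCluster (T ∩ E) s) (openCluster (Tᶜ ∩ E) s) * K₂ (openCluster (T ∩ E) s) (openCluster (Tᶜ ∩ E) s) := by
  have h := Box.freeze_boxes_sum_nonneg E s (Finset.univ.filter (fun T : Set (Sym2 V) => A ⊆ T)) (fun _ : Unit => A) (fun _ => A)
    (fun T hT => ⟨(), fun e he => ⟨fun _ => he, fun _ => (Finset.mem_filter.1 hT).2 he⟩⟩)
    (fun _ T hT => Finset.mem_filter.2 ⟨Finset.mem_univ _, fun e he => (hT e he).2 he⟩) (fun _ _ _ _ _ => rfl)
    (fun _ T T' _ hT' hflip => ?_) L hK₁ hso₁ hK₂ hso₂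
  · rw [Finset.filter_filter] at h
    exact h
  · -- red domination: the blue pairs of `T'` are red pairs of `T`
    refine Freeze.openCluster_mono (fun e he => ?_) s
    have he1 : e ∉ T' := he.1
    have he2 : e ∈ E := he.2
    refine ⟨?_, he2⟩
    by_cases heA : e ∈ A
    · exact absurd ((hT' e heA).2 heA) he1
    · by_contra heT
      exact he1 ((hflip e heA).2 heT)

/-- **The block-Fubini branch step.**  `g` ignores the pairs of `A` (`g (T \ A) = g T`),
`Σ_T g T ≥ 0`, and `h T = g T` when `T ∩ A = A₀`, `h T = 0` otherwise.  Then `Σ_T h T ≥ 0`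
(`Σ_T h = #{T : T ∩ A = A₀} · |Set (Sym2 V)|⁻¹ · Σ_T g` by `Cone.sum_block`). [this work] -/
theorem fubini_branch_nonneg (A A₀ : Set (Sym2 V)) (g h : Set (Sym2 V) → ℝ) (hg : 0 ≤ ∑ T : Set (Sym2 V), g T)
    (hgA : ∀ T : Set (Sym2 V), g (T \ A) = g T) (hh : ∀ T : Set (Sym2 V), T ∩ A = A₀ → h T = g T)
    (hh0 : ∀ T : Set (Sym2 V), T ∩ A ≠ A₀ → h T = 0) :
    0 ≤ ∑ T : Set (Sym2 V), h T := by
  set N : ℝ := (Fintype.card (Set (Sym2 V)) : ℝ) with hN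
  have hNpos : 0 < N := by rw [hN]; exact_mod_cast Fintype.card_pos
  have hblock := TwoStage.Cone.sum_block A (fun a b : Set (Sym2 V) => if a = A₀ then g b else 0)
  have hL : ∑ T : Set (Sym2 V), ∑ T' : Set (Sym2 V),
      (fun a b : Set (Sym2 V) => if a = A₀ then g b else 0) (T ∩ A) (T' \ A)
      = (∑ T : Set (Sym2 V), (if T ∩ A = A₀ then (1 : ℝ) else 0)) * ∑ T' : Set (Sym2 V), g T' := by
    rw [Finset.sum_mul]
    refine Finset.sum_congr rfl fun T _ => ?_
    show ∑ T', (if T ∩ A = A₀ then g (T' \ A) else 0) = _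
    by_cases hTA : T ∩ A = A₀
    · rw [if_pos hTA, one_mul]
      exact Finset.sum_congr rfl fun T' _ => by rw [if_pos hTA, hgA]
    · rw [if_neg hTA, zero_mul]
      exact Finset.sum_eq_zero fun T' _ => by rw [if_neg hTA]
  have hR : ∑ T : Set (Sym2 V), (fun a b : Set (Sym2 V) => if a = A₀ then g b else 0) (T ∩ A) (T \ A)
      = ∑ T : Set (Sym2 V), h T := by
    refine Finset.sum_congr rfl fun T _ => ?_
    show (if T ∩ A = A₀ then g (T \ A) else 0) = h T
    by_cases hTA : T ∩ A = A₀
    · rw [if_pos hTA, hgA, hh T hTA]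
    · rw [if_neg hTA, hh0 T hTA]
  rw [hL, hR] at hblock
  have hcnt : 0 ≤ ∑ T : Set (Sym2 V), (if T ∩ A = A₀ then (1 : ℝ) else 0) :=
    Finset.sum_nonneg fun T _ => by split_ifs <;> norm_num
  have h2 : 0 ≤ N * ∑ T : Set (Sym2 V), h T := by rw [← hblock]; exact mul_nonneg hcnt hg
  exact (mul_nonneg_iff_of_pos_left hNpos).1 h2

omit [Fintype V] in
/-- Red cluster of `K + sQ' + Q'P` when `sQ'` is BLUE and `Q'P` red: `X_K T`, plus `Q'` iff `P ∈ X_K T`. Here the case `P ∈ X_K T`.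
[this work] -/
theorem red_cluster_eq' {K : Set (Sym2 V)} {s P Q : V} (hPQ : P ≠ Q) (hQK : ∀ e ∈ K, Q ∉ e) {T : Set (Sym2 V)}
    (h1 : s(s, Q) ∉ T) (h2 : s(Q, P) ∈ T) (hP : P ∈ openCluster (T ∩ K) s) :
    openCluster (T ∩ insert s(s, Q) (insert s(Q, P) K)) s = insert Q (openCluster (T ∩ K) s) := by
  apply Set.Subset.antisymm
  · refine TwoStage.Fan.cluster_subset_of_closed (Set.mem_insert_of_mem _ (mem_openCluster_self _ s)) ?_
    intro u w hu huw
    obtain ⟨⟨hT, hE⟩, hne⟩ := (openGraph_adj _ u w).1 huw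
    rcases hE with hE | hE | hE
    · exact absurd (hE ▸ hT) h1
    · rcases Sym2.eq_iff.1 hE with ⟨rfl, rfl⟩ | ⟨rfl, rfl⟩
      · exact Set.mem_insert_of_mem _ hP
      · exact Set.mem_insert _ _
    · rcases hu with rfl | hu
      · exact absurd (Sym2.mem_mk_left u w) (hQK _ hE)
      · exact Set.mem_insert_of_mem _ (TwoStage.Cone.mem_cluster_of_adj hu ((openGraph_adj _ u w).2 ⟨⟨hT, hE⟩, hne⟩))
  · intro v hv
    rcases hv with rfl | hv
    · have hP' : P ∈ openCluster (T ∩ insert s(s, v) (insert s(v, P) K)) s :=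
        Freeze.openCluster_mono (Set.inter_subset_inter_right T ((Set.subset_insert _ _).trans (Set.subset_insert _ _))) s hP
      exact TwoStage.Cone.mem_cluster_of_adj hP' ((openGraph_adj _ P v).2
        ⟨⟨by rw [Sym2.eq_swap]; exact h2, Set.mem_insert_of_mem _ (by rw [Sym2.eq_swap]; exact Set.mem_insert _ _)⟩, hPQ⟩)
    · exact Freeze.openCluster_mono (Set.inter_subset_inter_right T
        ((Set.subset_insert _ _).trans (Set.subset_insert _ _))) s hv

omit [Fintype V] in
/-- Blue cluster of `K + sQ' + Q'P` when `sQ'` is BLUE and `Q'P` red: `Y_K T ∪ {Q'}`. [this work] -/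
theorem blue_cluster_eq' {K : Set (Sym2 V)} {s P Q : V} (hsQ : s ≠ Q) (hQK : ∀ e ∈ K, Q ∉ e) {T : Set (Sym2 V)}
    (h1 : s(s, Q) ∉ T) (h2 : s(Q, P) ∈ T) :
    openCluster (Tᶜ ∩ insert s(s, Q) (insert s(Q, P) K)) s = insert Q (openCluster (Tᶜ ∩ K) s) := by
  apply Set.Subset.antisymm
  · refine TwoStage.Fan.cluster_subset_of_closed (Set.mem_insert_of_mem _ (mem_openCluster_self _ s)) ?_
    intro u w hu huw
    obtain ⟨⟨hT, hE⟩, hne⟩ := (openGraph_adj _ u w).1 huw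
    rcases hE with hE | hE | hE
    · rcases Sym2.eq_iff.1 hE with ⟨-, rfl⟩ | ⟨rfl, rfl⟩
      · exact Set.mem_insert _ _
      · exact Set.mem_insert_of_mem _ (mem_openCluster_self _ _)
    · exact absurd (show s(u, w) ∈ T by rw [hE]; exact h2) hT
    · rcases hu with rfl | hu
      · exact absurd (Sym2.mem_mk_left u w) (hQK _ hE)
      · exact Set.mem_insert_of_mem _ (TwoStage.Cone.mem_cluster_of_adj hu ((openGraph_adj _ u w).2 ⟨⟨hT, hE⟩, hne⟩))
  · intro v hv
    rcases hv with rfl | hv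
    · exact TwoStage.Cone.mem_cluster_of_adj (mem_openCluster_self _ s)
        ((openGraph_adj _ s v).2 ⟨⟨h1, Set.mem_insert _ _⟩, hsQ⟩)
    · exact Freeze.openCluster_mono (Set.inter_subset_inter_right Tᶜ
        ((Set.subset_insert _ _).trans (Set.subset_insert _ _))) s hv

/-- **TOP_shift is stable under adding a common neighbour of `s` and `P`.**  `K` a pair set avoiding `Q'`; `s, P, Q'` pairwise distinct;
`E = K + sQ' + Q'P`.  If TOP_shift(K; P) holds then TOP_shift(E; P) holds:
`0 ≤ Σ_{T : P ∈ X_E T, P ∉ Y_E T} (F⁺(X_E T) − F⁻(Y_E T))·(G⁺(X_E T) − G⁻(Y_E T))` for all monotone `F⁻ ≤ F⁺`, `G⁻ ≤ G⁺`. [this work] -/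
theorem top_shift_insert_common (K : Set (Sym2 V)) (s P Q : V) (hsQ : s ≠ Q) (hPQ : P ≠ Q) (hsP : s ≠ P)
    (hQK : ∀ e ∈ K, Q ∉ e)
    (htop : ∀ Fp Fm Gp Gm : Set V → ℝ, Monotone Fp → Monotone Fm → (∀ S, Fm S ≤ Fp S) →
      Monotone Gp → Monotone Gm → (∀ S, Gm S ≤ Gp S) →
      0 ≤ ∑ T ∈ Finset.univ.filter (fun T : Set (Sym2 V) => P ∈ openCluster (T ∩ K) s ∧ P ∉ openCluster (Tᶜ ∩ K) s),
        (Fp (openCluster (T ∩ K) s) - Fm (openCluster (Tᶜ ∩ K) s)) * (Gp (openCluster (T ∩ K) s) - Gm (openCluster (Tᶜ ∩ K) s)))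
    (Fp Fm Gp Gm : Set V → ℝ) (hFp : Monotone Fp) (hFm : Monotone Fm) (hF : ∀ S, Fm S ≤ Fp S)
    (hGp : Monotone Gp) (hGm : Monotone Gm) (hG : ∀ S, Gm S ≤ Gp S) :
    0 ≤ ∑ T ∈ Finset.univ.filter (fun T : Set (Sym2 V) =>
        P ∈ openCluster (T ∩ insert s(s, Q) (insert s(Q, P) K)) s ∧ P ∉ openCluster (Tᶜ ∩ insert s(s, Q) (insert s(Q, P) K)) s),
      (Fp (openCluster (T ∩ insert s(s, Q) (insert s(Q, P) K)) s) - Fm (openCluster (Tᶜ ∩ insert s(s, Q) (insert s(Q, P) K)) s)) *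
        (Gp (openCluster (T ∩ insert s(s, Q) (insert s(Q, P) K)) s) - Gm (openCluster (Tᶜ ∩ insert s(s, Q) (insert s(Q, P) K)) s)) := by
  set E : Set (Sym2 V) := insert s(s, Q) (insert s(Q, P) K) with hEdef
  have hsQE : s(s, Q) ∈ E := Set.mem_insert _ _
  have hQPE : s(Q, P) ∈ E := Set.mem_insert_of_mem _ (Set.mem_insert _ _)
  have hne : s(s, Q) ≠ s(Q, P) := by
    intro h
    rcases Sym2.eq_iff.1 h with ⟨h1, -⟩ | ⟨h2, -⟩
    · exact hsQ h1
    · exact hsP h2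
  set A : Set (Sym2 V) := {s(s, Q), s(Q, P)} with hAdef
  have hAK : ∀ e ∈ A, e ∉ K := by
    intro e he heK
    rcases he with rfl | he
    · exact hQK _ heK (Sym2.mem_mk_right s Q)
    · rw [Set.mem_singleton_iff.1 he] at heK; exact hQK _ heK (Sym2.mem_mk_left Q P)
  have hKsub : K ⊆ E := (Set.subset_insert _ _).trans (Set.subset_insert _ _)
  -- `Q` is never in a `K`-cluster of `s`
  have hQclK : ∀ η : Set (Sym2 V), Q ∉ openCluster (η ∩ K) s := fun η hQ => by
    obtain ⟨u', hu'⟩ := TopEar.exists_pair_of_mem_cluster hsQ.symm hQ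
    exact hQK _ hu'.2 (Sym2.mem_mk_left Q u')
  -- the summand as a function of the branch pattern
  let Φ : Set (Sym2 V) → ℝ := fun T =>
    (Fp (openCluster (T ∩ E) s) - Fm (openCluster (Tᶜ ∩ E) s)) * (Gp (openCluster (T ∩ E) s) - Gm (openCluster (Tᶜ ∩ E) s))
  -- rewrite the filtered sum as a sum of an indicator-weighted function and split into the four colour patterns of `A`
  have hsplit : ∀ T : Set (Sym2 V),
      (if P ∈ openCluster (T ∩ E) s ∧ P ∉ openCluster (Tᶜ ∩ E) s then
          (Fp (openCluster (T ∩ E) s) - Fm (openCluster (Tᶜ ∩ E) s)) * (Gp (openCluster (T ∩ E) s) - Gm (openCluster (Tᶜ ∩ E) s)) else 0) =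
        (if (P ∈ openCluster (T ∩ E) s ∧ P ∉ openCluster (Tᶜ ∩ E) s) ∧ T ∩ A = A then Φ T else 0) +
        (if (P ∈ openCluster (T ∩ E) s ∧ P ∉ openCluster (Tᶜ ∩ E) s) ∧ T ∩ A = {s(s, Q)} then Φ T else 0) +
        (if (P ∈ openCluster (T ∩ E) s ∧ P ∉ openCluster (Tᶜ ∩ E) s) ∧ T ∩ A = {s(Q, P)} then Φ T else 0) := by
    intro T
    by_cases hev : P ∈ openCluster (T ∩ E) s ∧ P ∉ openCluster (Tᶜ ∩ E) s
    · rw [if_pos hev]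
      -- which pairs of `A` are red?
      by_cases h1 : s(s, Q) ∈ T
      · by_cases h2 : s(Q, P) ∈ T
        · have hTA : T ∩ A = A := Set.inter_eq_right.2 (by
            intro e he; rcases he with rfl | he
            · exact h1
            · rw [Set.mem_singleton_iff.1 he]; exact h2)
          have hTA2 : T ∩ A ≠ {s(s, Q)} := by
            rw [hTA]; intro h
            have : s(Q, P) ∈ ({s(s, Q)} : Set (Sym2 V)) := h ▸ (Set.mem_insert_of_mem _ rfl : s(Q, P) ∈ A)
            exact hne (Set.mem_singleton_iff.1 this).symm
          have hTA3 : T ∩ A ≠ {s(Q, P)} := by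
            rw [hTA]; intro h
            have : s(s, Q) ∈ ({s(Q, P)} : Set (Sym2 V)) := h ▸ (Set.mem_insert _ _ : s(s, Q) ∈ A)
            exact hne (Set.mem_singleton_iff.1 this)
          rw [if_pos ⟨hev, hTA⟩, if_neg (fun h => hTA2 h.2), if_neg (fun h => hTA3 h.2)]; ring
        · have hTA : T ∩ A = {s(s, Q)} := by
            ext e; simp only [Set.mem_inter_iff, hAdef, Set.mem_insert_iff, Set.mem_singleton_iff]
            constructor
            · rintro ⟨he, rfl | rfl⟩
              · rfl
              · exact absurd he h2
            · rintro rfl; exact ⟨h1, Or.inl rfl⟩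
          have hTA1 : T ∩ A ≠ A := by
            rw [hTA]; intro h
            have : s(Q, P) ∈ ({s(s, Q)} : Set (Sym2 V)) := h.symm ▸ (Set.mem_insert_of_mem _ rfl : s(Q, P) ∈ A)
            exact hne (Set.mem_singleton_iff.1 this).symm
          have hTA3 : T ∩ A ≠ {s(Q, P)} := by
            rw [hTA]; intro h
            have : s(s, Q) ∈ ({s(Q, P)} : Set (Sym2 V)) := h ▸ (rfl : s(s, Q) ∈ ({s(s, Q)} : Set (Sym2 V)))
            exact hne (Set.mem_singleton_iff.1 this)
          rw [if_neg (fun h => hTA1 h.2), if_pos ⟨hev, hTA⟩, if_neg (fun h => hTA3 h.2)]; ring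
      · -- `sQ` blue: then `Q ∈ Y_E`, so `QP` must be red (else `P ∈ Y_E`)
        have hQY : Q ∈ openCluster (Tᶜ ∩ E) s :=
          TwoStage.Cone.mem_cluster_of_adj (mem_openCluster_self _ s) ((openGraph_adj _ s Q).2 ⟨⟨h1, hsQE⟩, hsQ⟩)
        have h2 : s(Q, P) ∈ T := by
          by_contra h2
          exact hev.2 (TwoStage.Cone.mem_cluster_of_adj hQY ((openGraph_adj _ Q P).2 ⟨⟨h2, hQPE⟩, hPQ.symm⟩))
        have hTA : T ∩ A = {s(Q, P)} := by
          ext e; simp only [Set.mem_inter_iff, hAdef, Set.mem_insert_iff, Set.mem_singleton_iff]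
          constructor
          · rintro ⟨he, rfl | rfl⟩
            · exact absurd he h1
            · rfl
          · rintro rfl; exact ⟨h2, Or.inr rfl⟩
        have hTA1 : T ∩ A ≠ A := by
          rw [hTA]; intro h
          have : s(s, Q) ∈ ({s(Q, P)} : Set (Sym2 V)) := h.symm ▸ (Set.mem_insert _ _ : s(s, Q) ∈ A)
          exact hne (Set.mem_singleton_iff.1 this)
        have hTA2 : T ∩ A ≠ {s(s, Q)} := by
          rw [hTA]; intro h
          have : s(Q, P) ∈ ({s(s, Q)} : Set (Sym2 V)) := h ▸ (rfl : s(Q, P) ∈ ({s(Q, P)} : Set (Sym2 V)))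
          exact hne (Set.mem_singleton_iff.1 this).symm
        rw [if_neg (fun h => hTA1 h.2), if_neg (fun h => hTA2 h.2), if_pos ⟨hev, hTA⟩]; ring
    · rw [if_neg hev, if_neg (fun h => hev h.1), if_neg (fun h => hev h.1), if_neg (fun h => hev h.1)]; ring
  rw [Finset.sum_filter, Finset.sum_congr rfl (fun T _ => hsplit T), Finset.sum_add_distrib, Finset.sum_add_distrib]
  refine add_nonneg (add_nonneg ?_ ?_) ?_
  · -- both red: the cylinder `{A ⊆ T} ∩ {P ∉ Y}`, and `P ∈ X` is automatic
    have hK₁ : ∀ ⦃A' A'' B' B'' : Set V⦄, A' ⊆ A'' → B'' ⊆ B' → Fp A' - Fm B' ≤ Fp A'' - Fm B'' :=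
      fun A' A'' B' B'' hA hB => sub_le_sub (hFp hA) (hFm hB)
    have hK₂ : ∀ ⦃A' A'' B' B'' : Set V⦄, A' ⊆ A'' → B'' ⊆ B' → Gp A' - Gm B' ≤ Gp A'' - Gm B'' :=
      fun A' A'' B' B'' hA hB => sub_le_sub (hGp hA) (hGm hB)
    have hso₁ : ∀ A' B' : Set V, 0 ≤ (Fp A' - Fm B') + (Fp B' - Fm A') := fun A' B' => by linarith [hF A', hF B']
    have hso₂ : ∀ A' B' : Set V, 0 ≤ (Gp A' - Gm B') + (Gp B' - Gm A') := fun A' B' => by linarith [hG A', hG B']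
    have hcyl := cylinder_notY_sum_nonneg E s A {P} hK₁ hso₁ hK₂ hso₂
    have hiff : ∀ T : Set (Sym2 V), ((P ∈ openCluster (T ∩ E) s ∧ P ∉ openCluster (Tᶜ ∩ E) s) ∧ T ∩ A = A) ↔
        (A ⊆ T ∧ ∀ Q₁ ∈ ({P} : Set V), Q₁ ∉ openCluster (Tᶜ ∩ E) s) := by
      intro T
      constructor
      · rintro ⟨⟨-, hPY⟩, hTA⟩
        exact ⟨fun e he => (hTA.symm ▸ he : e ∈ T ∩ A).1, fun Q₁ hQ₁ => by rw [Set.mem_singleton_iff.1 hQ₁]; exact hPY⟩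
      · rintro ⟨hAT, hL⟩
        have h1 : s(s, Q) ∈ T := hAT (Set.mem_insert _ _)
        have h2 : s(Q, P) ∈ T := hAT (Set.mem_insert_of_mem _ rfl)
        refine ⟨⟨?_, hL P rfl⟩, Set.inter_eq_right.2 hAT⟩
        exact TwoStage.Cone.mem_cluster_of_adj
          (TwoStage.Cone.mem_cluster_of_adj (mem_openCluster_self _ s) ((openGraph_adj _ s Q).2 ⟨⟨h1, hsQE⟩, hsQ⟩))
          ((openGraph_adj _ Q P).2 ⟨⟨h2, hQPE⟩, hPQ.symm⟩)
    rw [← Finset.sum_filter]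
    have hFc : Finset.univ.filter (fun T : Set (Sym2 V) =>
          (P ∈ openCluster (T ∩ E) s ∧ P ∉ openCluster (Tᶜ ∩ E) s) ∧ T ∩ A = A) =
        Finset.univ.filter (fun T : Set (Sym2 V) => A ⊆ T ∧ ∀ Q₁ ∈ ({P} : Set V), Q₁ ∉ openCluster (Tᶜ ∩ E) s) :=
      Finset.filter_congr (fun T _ => hiff T)
    rw [hFc]
    exact hcyl
  · -- `sQ` red, `QP` blue: the TOP sum of `K` for `F⁺(· ∪ Q), G⁺(· ∪ Q)`
    let Fq : Set V → ℝ := fun S => Fp (insert Q S)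
    let Gq : Set V → ℝ := fun S => Gp (insert Q S)
    have hFq : Monotone Fq := fun S S' h => hFp (Set.insert_subset_insert h)
    have hGq : Monotone Gq := fun S S' h => hGp (Set.insert_subset_insert h)
    have hFq' : ∀ S, Fm S ≤ Fq S := fun S => (hF S).trans (hFp (Set.subset_insert _ _))
    have hGq' : ∀ S, Gm S ≤ Gq S := fun S => (hG S).trans (hGp (Set.subset_insert _ _))
    let g : Set (Sym2 V) → ℝ := fun T =>
      if P ∈ openCluster (T ∩ K) s ∧ P ∉ openCluster (Tᶜ ∩ K) s then
        (Fq (openCluster (T ∩ K) s) - Fm (openCluster (Tᶜ ∩ K) s)) * (Gq (openCluster (T ∩ K) s) - Gm (openCluster (Tᶜ ∩ K) s))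
      else 0
    refine fubini_branch_nonneg A {s(s, Q)} g _ ?_ ?_ ?_ ?_
    · rw [← Finset.sum_filter]; exact htop Fq Fm Gq Gm hFq hFm hFq' hGq hGm hGq'
    · intro T; simp only [g, TopEar.inter_diff_eq hAK, TopEar.compl_diff_inter_eq hAK]
    · intro T hTA
      have h1 : s(s, Q) ∈ T := (hTA.symm ▸ (rfl : s(s, Q) ∈ ({s(s, Q)} : Set (Sym2 V))) : s(s, Q) ∈ T ∩ A).1
      have h2 : s(Q, P) ∉ T := fun h => by
        have : s(Q, P) ∈ T ∩ A := ⟨h, Set.mem_insert_of_mem _ rfl⟩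
        rw [hTA] at this; exact hne (Set.mem_singleton_iff.1 this).symm
      have hXeq : openCluster (T ∩ E) s = insert Q (openCluster (T ∩ K) s) := TopEar.red_cluster_eq hsQ hQK h1 h2
      by_cases hev : P ∈ openCluster (T ∩ E) s ∧ P ∉ openCluster (Tᶜ ∩ E) s
      · obtain ⟨hPXT, hPYT⟩ := hev
        have hPYK : P ∉ openCluster (Tᶜ ∩ K) s := fun hP => hPYT (Freeze.openCluster_mono (Set.inter_subset_inter_right Tᶜ hKsub) s hP)
        have hYeq : openCluster (Tᶜ ∩ E) s = openCluster (Tᶜ ∩ K) s := TopEar.blue_cluster_eq hsQ hQK h1 hPYK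
        have hPXK : P ∈ openCluster (T ∩ K) s := by
          have := hPXT; rw [hXeq] at this
          rcases this with h | h
          · exact absurd h hPQ
          · exact h
        show (if (P ∈ openCluster (T ∩ E) s ∧ P ∉ openCluster (Tᶜ ∩ E) s) ∧ T ∩ A = {s(s, Q)} then Φ T else 0) = g T
        rw [if_pos ⟨⟨hPXT, hPYT⟩, hTA⟩]
        simp only [g, if_pos (show P ∈ openCluster (T ∩ K) s ∧ P ∉ openCluster (Tᶜ ∩ K) s from ⟨hPXK, hPYK⟩), Φ, Fq, Gq, hXeq, hYeq]
      · show (if (P ∈ openCluster (T ∩ E) s ∧ P ∉ openCluster (Tᶜ ∩ E) s) ∧ T ∩ A = {s(s, Q)} then Φ T else 0) = g T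
        rw [if_neg (fun h => hev h.1)]
        have hnot : ¬ (P ∈ openCluster (T ∩ K) s ∧ P ∉ openCluster (Tᶜ ∩ K) s) := by
          rintro ⟨hPXK, hPYK⟩
          refine hev ⟨?_, ?_⟩
          · rw [hXeq]; exact Set.mem_insert_of_mem _ hPXK
          · rw [TopEar.blue_cluster_eq hsQ hQK h1 hPYK]; exact hPYK
        simp only [g, if_neg hnot]
    · intro T hTA
      show (if (P ∈ openCluster (T ∩ E) s ∧ P ∉ openCluster (Tᶜ ∩ E) s) ∧ T ∩ A = {s(s, Q)} then Φ T else 0) = 0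
      rw [if_neg (fun h => hTA h.2)]
  · -- `sQ` blue, `QP` red: the TOP sum of `K` with both sides shifted by `Q`
    let Fq : Set V → ℝ := fun S => Fp (insert Q S)
    let Fmq : Set V → ℝ := fun S => Fm (insert Q S)
    let Gq : Set V → ℝ := fun S => Gp (insert Q S)
    let Gmq : Set V → ℝ := fun S => Gm (insert Q S)
    have hFq : Monotone Fq := fun S S' h => hFp (Set.insert_subset_insert h)
    have hGq : Monotone Gq := fun S S' h => hGp (Set.insert_subset_insert h)
    have hFmq : Monotone Fmq := fun S S' h => hFm (Set.insert_subset_insert h)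
    have hGmq : Monotone Gmq := fun S S' h => hGm (Set.insert_subset_insert h)
    have hFq' : ∀ S, Fmq S ≤ Fq S := fun S => hF _
    have hGq' : ∀ S, Gmq S ≤ Gq S := fun S => hG _
    let g : Set (Sym2 V) → ℝ := fun T =>
      if P ∈ openCluster (T ∩ K) s ∧ P ∉ openCluster (Tᶜ ∩ K) s then
        (Fq (openCluster (T ∩ K) s) - Fmq (openCluster (Tᶜ ∩ K) s)) * (Gq (openCluster (T ∩ K) s) - Gmq (openCluster (Tᶜ ∩ K) s))
      else 0
    refine fubini_branch_nonneg A {s(Q, P)} g _ ?_ ?_ ?_ ?_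
    · rw [← Finset.sum_filter]; exact htop Fq Fmq Gq Gmq hFq hFmq hFq' hGq hGmq hGq'
    · intro T; simp only [g, TopEar.inter_diff_eq hAK, TopEar.compl_diff_inter_eq hAK]
    · intro T hTA
      have h2 : s(Q, P) ∈ T := (hTA.symm ▸ (rfl : s(Q, P) ∈ ({s(Q, P)} : Set (Sym2 V))) : s(Q, P) ∈ T ∩ A).1
      have h1 : s(s, Q) ∉ T := fun h => by
        have : s(s, Q) ∈ T ∩ A := ⟨h, Set.mem_insert _ _⟩
        rw [hTA] at this; exact hne (Set.mem_singleton_iff.1 this)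
      have hYeq : openCluster (Tᶜ ∩ E) s = insert Q (openCluster (Tᶜ ∩ K) s) := blue_cluster_eq' hsQ hQK h1 h2
      by_cases hev : P ∈ openCluster (T ∩ E) s ∧ P ∉ openCluster (Tᶜ ∩ E) s
      · obtain ⟨hPXT, hPYT⟩ := hev
        have hPYK : P ∉ openCluster (Tᶜ ∩ K) s := fun hP => hPYT (Freeze.openCluster_mono (Set.inter_subset_inter_right Tᶜ hKsub) s hP)
        -- `P ∈ X_K T`: a red path to `P` in `E` not using `sQ` (blue); the last step into `Q` would need... use closedness
        have hPXK : P ∈ openCluster (T ∩ K) s := by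
          -- closed set: `X_K T`, plus `Q` once `P ∈ X_K T`
          have hsub : openCluster (T ∩ E) s ⊆ {v | v ∈ openCluster (T ∩ K) s ∨ (v = Q ∧ P ∈ openCluster (T ∩ K) s)} := by
            refine TwoStage.Fan.cluster_subset_of_closed (Or.inl (mem_openCluster_self _ s)) ?_
            intro u w hu huw
            obtain ⟨⟨hT, hE⟩, hne'⟩ := (openGraph_adj _ u w).1 huw
            rcases hE with hE | hE | hE
            · exact absurd (hE ▸ hT) h1
            · rcases Sym2.eq_iff.1 hE with ⟨rfl, rfl⟩ | ⟨rfl, rfl⟩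
              · -- `u = Q`, `w = P`
                rcases hu with hu | ⟨-, hP⟩
                · exact absurd hu (hQclK T)
                · exact Or.inl hP
              · -- `u = P`, `w = Q`
                rcases hu with hu | ⟨hPQ', -⟩
                · exact Or.inr ⟨rfl, hu⟩
                · exact absurd hPQ' hPQ
            · rcases hu with hu | ⟨rfl, -⟩
              · exact Or.inl (TwoStage.Cone.mem_cluster_of_adj hu ((openGraph_adj _ u w).2 ⟨⟨hT, hE⟩, hne'⟩))
              · exact absurd (Sym2.mem_mk_left u w) (hQK _ hE)
          rcases hsub hPXT with h | ⟨h, -⟩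
          · exact h
          · exact absurd h hPQ
        have hXeq : openCluster (T ∩ E) s = insert Q (openCluster (T ∩ K) s) := red_cluster_eq' hPQ hQK h1 h2 hPXK
        show (if (P ∈ openCluster (T ∩ E) s ∧ P ∉ openCluster (Tᶜ ∩ E) s) ∧ T ∩ A = {s(Q, P)} then Φ T else 0) = g T
        rw [if_pos ⟨⟨hPXT, hPYT⟩, hTA⟩]
        simp only [g, if_pos (show P ∈ openCluster (T ∩ K) s ∧ P ∉ openCluster (Tᶜ ∩ K) s from ⟨hPXK, hPYK⟩), Φ, Fq, Fmq, Gq, Gmq,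
          hXeq, hYeq]
      · show (if (P ∈ openCluster (T ∩ E) s ∧ P ∉ openCluster (Tᶜ ∩ E) s) ∧ T ∩ A = {s(Q, P)} then Φ T else 0) = g T
        rw [if_neg (fun h => hev h.1)]
        have hnot : ¬ (P ∈ openCluster (T ∩ K) s ∧ P ∉ openCluster (Tᶜ ∩ K) s) := by
          rintro ⟨hPXK, hPYK⟩
          refine hev ⟨Freeze.openCluster_mono (Set.inter_subset_inter_right T hKsub) s hPXK, ?_⟩
          rw [hYeq]
          rintro (h | h)
          · exact hPQ h
          · exact hPYK h
        simp only [g, if_neg hnot]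
    · intro T hTA
      show (if (P ∈ openCluster (T ∩ E) s ∧ P ∉ openCluster (Tᶜ ∩ E) s) ∧ T ∩ A = {s(Q, P)} then Φ T else 0) = 0
      rw [if_neg (fun h => hTA h.2)]

end TopCommon

end Antithetic

end Summit.CriticalPhenomena.PercolationContinuityZ3.Theorems
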